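import Mathlib
import HarnessLib
import Summits.NavierStokesRegularity.NavierStokesRegularity.Theorems.TaylorModelRungThreeCertificateFormatV

/-!
# Crux K1b-DR (stmt-NavierStokesRegularity-23954), line `taylor-model` — v3 certificate: TEXT-CODED dyadic tables
# (cert2lean-v3 data encoding; successor engine-1 g67)

The v3 certificate data (`CertTablesV`: per stage ≈ 4·10⁵ dyadics, mostly the dense `88×88` checkpoint matrices
`Vc`, `B`, `Z` of every chunk start) is far too large for term-level array literals to elaborate quickly. The
generated data modules therefore carry every dyadic table as ONE STRING LITERAL and decode it when the module
initialises (one left fold over the characters): `DyadText.vec "m@e,m@e,…"`, `DyadText.mat "row;row;…"`,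
`DyadText.ivec "lo~hi,…"`, `DyadText.imat`. Grammar: a dyadic `m·2^e` is `m` or `m@e` (decimal integers, optional
sign `-`); entries are separated by `,`, the two ends of an interval by `~`, matrix rows are TERMINATED by `;`; every
other character (white space) is ignored. Nothing here carries a claim: the decoded tables are DATA the checker tests.
MODEL-lattice bookkeeping only (rung TL-M3); nothing here is a statement about the Navier–Stokes equations.
-/

-- the sub-problem namespace repeats the summit name by design (D-0017)
set_option linter.dupNamespace false

namespace Summit.NavierStokesRegularity.NavierStokesRegularity.Theorems.TaylorModelCert

namespace DyadText

/-- Decoder state: finished rows, the current row, and the number being read (`m` = mantissa already closed by `@`,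
`acc`/`neg` = digits and sign of the current integer, `expPart` = reading the exponent, `dirty` = an entry is open).
[folklore] -/
structure St where
  rows : Array (Array Dyad) := #[]
  row : Array Dyad := #[]
  m : ℤ := 0
  acc : ℕ := 0
  neg : Bool := false
  expPart : Bool := false
  dirty : Bool := false

namespace St

/-- The integer read so far. [folklore] -/
def num (st : St) : ℤ := if st.neg then -(st.acc : ℤ) else st.acc

/-- The dyadic of the open entry. [folklore] -/
def entry (st : St) : Dyad := if st.expPart then ⟨st.m, st.num⟩ else ⟨st.num, 0⟩

/-- Close the open entry (if any) into the current row. [folklore] -/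
def endEntry (st : St) : St :=
  { st with row := if st.dirty then st.row.push st.entry else st.row,
            m := 0, acc := 0, neg := false, expPart := false, dirty := false }

/-- Close the current row. [folklore] -/
def endRow (st : St) : St :=
  let st' := st.endEntry
  { st' with rows := st'.rows.push st'.row, row := #[] }

/-- Consume one character. [folklore] -/
def feed (st : St) (ch : Char) : St :=
  if ch.isDigit then { st with acc := st.acc * 10 + (ch.toNat - 48), dirty := true }
  else if ch = '-' then { st with neg := true, dirty := true }
  else if ch = '@' then { st with m := st.num, acc := 0, neg := false, expPart := true, dirty := true }
  else if ch = ',' || ch = '~' then st.endEntry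
  else if ch = ';' then st.endRow
  else st

end St

/-- Run the decoder over a string. [folklore] -/
def parse (s : String) : St := s.foldl St.feed {}

/-- `"m@e,m,…"` ↦ a dyadic vector. [folklore] -/
def vec (s : String) : Array Dyad := (parse s).endEntry.row

/-- `"row;row;…;"` (rows terminated by `;`) ↦ a dyadic matrix; an unterminated last row is kept. [folklore] -/
def mat (s : String) : Array (Array Dyad) :=
  let st := (parse s).endEntry
  if st.row.size = 0 then st.rows else st.rows.push st.row

/-- Consecutive pairs of a dyadic array as intervals `[a₀,a₁], [a₂,a₃], …`. [folklore] -/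
def pairs (a : Array Dyad) : Array IntervalD :=
  Array.ofFn (n := a.size / 2) fun i => ⟨a.getD (2 * i) Dyad.zero, a.getD (2 * i + 1) Dyad.zero⟩

/-- `"lo~hi,lo~hi,…"` ↦ an interval vector. [folklore] -/
def ivec (s : String) : Array IntervalD := pairs (vec s)

/-- `"lo~hi,…;…;"` ↦ an interval matrix. [folklore] -/
def imat (s : String) : Array (Array IntervalD) := (mat s).map pairs

/-- A v3 NODE STATE from its five text-coded tables (`Vc`, `e`, `B`, `rp`, `Z`). [folklore] -/
def node (Vc e B rp Z : String) : NodeV :=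
  { Vc := mat Vc, e := vec e, B := mat B, rp := vec rp, Z := imat Z }

/-- A v3 SUB-STEP record from its step size and text-coded next centre (no emitted hull boxes). [folklore] -/
def step (h : Dyad) (xn : String) : StepV :=
  { h := h, xn := vec xn, lo := #[], hi := #[] }

end DyadText

end Summit.NavierStokesRegularity.NavierStokesRegularity.Theorems.TaylorModelCert
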